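import Literature.MathematicalPhysics.QuantumFieldTheory.Balaban1983to89.B15DeterminingSetsB

/-!
# `Balaban1983to89.B15DeterminingSetsBBackgrounds` — [Balaban1989LargeFieldI] (= [B15]) (1.74), (1.77), Prop. 1 (1.78), (1.79) pp. 192–195 OVER A **BOND-LEVEL SOLUTION MAP**
# `bg : B15DeterminingSetsB.DetBackgroundB P G av` AND A **BOND-LEVEL DETERMINING DATUM** `𝔅 : BDetSet P` — the print-datum parametrisation of `B15DeterminingSets` §LocalBackgrounds
# (`bgKZ ∕ fun177 ∕ IsVLambda ∕ bgU0 ∕ wilsonAction4_bgU0_le`); the site-level (reading-(b)) objects ARE the instance `(bg.toDetBackground, bondsDet 𝔹)` by `rfl`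

statement-level skeleton of published theorems with citation tags; proofs where landed; nothing here is a claim about the
Yang–Mills mass gap

Cell `pub-ymgap` (HUMAN RULINGS D-0062 ∕ D-0149), lane `pub-ymgap-dag-n12-c` g34 (R134 seat (a), N12 = [B15], s1 — the lane of [B15] Proposition 1; `--kind definition --supports`
K1⁹ `stmt-QuantumFields-27364`; count-neutral).  (E1) variant (iii-b): the N12-side ROOT of the re-attachment of N12's Proposition-1 road to print's [II] (2.3) minimiser (dag-n12-d's
blast census I.32897 (3)(i) «B15 §1 carrier ᴮ (`fun177B ∕ bgKZB ∕ …`)», node00-def-RR-2 I.32968 concurring on scope).  F0a (`B15DeterminingSetsB`, RR-2 g23) typed [III] (2.10)–(2.12)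
over a bond datum and the solution map `DetBackgroundB` with its pull-back `toDetBackground`; THIS FILE types the three [B15] objects N12 reads — the function (1.74) `U_{k,Z}(V_k) =
U(𝔅, M˙(Q^{s*}V_k))`, the function (1.77) `V_k ↦ A(U_{k,Z}(V_k))`, Proposition 1's minimiser predicate and (1.79) — over `(bg : DetBackgroundB, 𝔅 : BDetSet)`.

HONESTY GUARD (director-ym №338 (5)).  PURELY ADDITIVE: print-datum parametrisation of `B15DeterminingSets` §LocalBackgrounds (FLAG №16 ∕ LOCATE-HSEAM 5d3298b8d191f169); the
(b)-instances `bgKZ ∕ fun177 ∕ IsVLambda ∕ bgU0` stay landed and true on their own text; NOTHING in `B15DeterminingSets` or `B15DeterminingSetsB` is edited; every declaration below is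
NEW, and at a bond-level solution map `bg` each old object at the PULLED-BACK site-level map `bg.toDetBackground` and a site-level datum `𝔹` IS the new one at `bondsDet 𝔹` by `rfl`
(`bgKZ_toDetBackground`, `fun177_toDetBackground`, `isVLambda_toDetBackground_iff`, `bgU0_toDetBackground`).  No displayed premise of any consumer is deleted or weakened.

WHY.  N12's junction of record «12Q-DIRECT v14ᴸ» (#10983) pins the large-field layer to `InstOn.std (Node00.bgMSCoPOfRecord …)` — [B15] §1's carrier at the SITE-LEVEL solution map of
record, whose (1.74) `bgKZ bg (Bj M₁ Z k) Q^{s*}` constrains the minimiser on every bond MEETING the members of `Bj M₁ Z k = genSet (maxDomT M₁ Z) k` (reading (b)).  After Stage 2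
(director-ym №343) the record's background is print's (2.3) minimiser `Node00.bgMSCoPOfRecordB : DetBackgroundB` (node00-def-R S2b ✓p766661), with `(bgMSCoPOfRecordAtB …).toDetBackground
= bgMSCoPOfRecordAt …` — so today's N12 road IS the instance `𝔅 := bondsDet (Bj …)` of a road over `DetBackgroundB`, and its re-attachment to the record is the instance `𝔅 :=
lamBondsSeq (maxDomT M₁ Z) k` of the same road.  The road's carrier (`B15Prop1Carrier.Inst`, field `f`) is already abstract in the function; only print's INSTANCE `Inst.std ∕
fun177std ∕ IsVLambdaStd ∕ bgKZstd` (`B15Sect1Instances`, `B15Prop1Carrier` §9) names `(bg, Bj M₁ Z k)` — their `(bg : DetBackgroundB, 𝔅)` editions key on THIS file.  (Design and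
census: the lane's memo `N12-REATTACHMENT-DESIGN-2026-08-30.md`.)

WHAT IS HERE (STATEMENT-ONLY: FOUR definitions + `rfl` ∕ `Iff.rfl` bookkeeping; NO analytic content; the theorems with content live in the sibling THEOREMS-ONLY module
`B15DeterminingSetsBBackgroundsBridges`).
* §1 `bgKZB bg 𝔅 Qs Vk := bg.U 𝔅 (M˙(Qs Vk))` ((1.74)), `fun177B` ((1.77)), `IsVLambdaB` (Prop. 1's «a minimum of the function»), `bgU0B` ((1.79)); `bgKZB_apply`, `fun177B_apply`,
  `bgU0B_eq` (`rfl`).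
* §2 the (b)-instances by `rfl`: `bgKZ_toDetBackground`, `fun177_toDetBackground`, `isVLambda_toDetBackground_iff`, `bgU0_toDetBackground`.
NOT HERE (sibling `…Bridges`): `wilsonAction4_bgU0B_le`, `IsVLambdaB.eq_off`, `isMinimizerB_bgKZB` (the [III] (2.12) property of (1.74) on `bg.dom 𝔅` — the one place the road READS
`bg.isMinimizer`), `agreeOnB_bgKZB`, `bgKZB_mem_reg`, and the one inequality between the two roads `IsMinimizerB.wilsonAction4_le_of_anti` ∕
`wilsonAction4_U_lamBondsSeq_le_U_bondsDet_genSet` (print's (2.3) minimiser has action at most the reading-(b) minimiser's, same solution map, same data).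

HONEST SCOPE.  Definitions + `rfl` bookkeeping; nothing of Bałaban's analysis asserted or proved; no named fact inhabited; count-neutral; N12 NOT discharged;
K0⁷ ∕ K1⁹ NOT closed; one finite 𝕋⁴ programme at fixed ε — nothing continuum ∕ ℝ⁴ ∕ OS; the Yang–Mills mass gap (Clay) is NOT proved by any of this.  No `instance`, no `notation`.

References: [B15] = [Balaban1989LargeFieldI] (1.74) p.192, (1.77)–(1.78) Prop. 1 p.194, (1.79) p.195; [III] = [Balaban1988Convergent] (2.10)–(2.13) pp.256–257; [II] =
[Balaban1984PropagatorsII] (2.3) p.224; [I] = [Balaban1987RG1] (0.1) p.251.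
-/

open Set

namespace Literature.MathematicalPhysics.QuantumFieldTheory.Balaban1983to89.B15DeterminingSetsB

open B15DeterminingSets

variable {P : Params}

/-! ## §1  (1.74), (1.77), Prop. 1's minimiser, (1.79) over `(bg : DetBackgroundB, 𝔅 : BDetSet)` -/

section LocalBackgroundsB

variable {G : Type*} [GaugeGroup G] {av : ∀ j, Averaging P j G} (bg : DetBackgroundB P G av) {k : ℕ}

/-- **[B15] (1.74) OVER A BOND-LEVEL SOLUTION MAP AND DATUM**: `U_{k,Z}(V_k) = U(𝔅, M˙(Q_k^{s*}V_k))` — `B15DeterminingSets.bgKZ` with the site-level pair `(bg, 𝔹_k(Z))` replaced by a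
bond-level solution map `bg : DetBackgroundB` (F0a) and a bond datum `𝔅` (reading (b): `bondsDet (Bj M₁ Z k)`; print's [II] (2.3): `lamBondsSeq (maxDomT M₁ Z) k`).  Verbatim p. 192:
*"Take the function U_{k,Z}(V_k) given by U_{k,Z} = U_{k,Z}(V_k) = U(𝔹_k(Z), M˙(Q_k^{s*}V_k)). (1.74)"*.  Print-datum parametrisation of `bgKZ` (FLAG №16 ∕ LOCATE-HSEAM
5d3298b8d191f169); the (b)-instance `bgKZ` stays landed and true on its own text (`bgKZ_toDetBackground`). [cite: Balaban1989LargeFieldI, (1.74) p.192; Balaban1988Convergent, (2.12)–(2.13) p.256–257; Balaban1984PropagatorsII, (2.3) p.224] -/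
def bgKZB (𝔅 : BDetSet P) (Qs : GaugeField P k G → GaugeField P 0 G) (Vk : GaugeField P k G) : GaugeField P 0 G :=
  bg.U 𝔅 (avgFamily av (Qs Vk))

/-- **[B15] (1.77) OVER `(bg, 𝔅)`**: the Wilson action of (1.74) as a function of `V_k` — verbatim p. 194: *"Consider the function V_k↾_Λ → A(U_{k,Z}(V_k)). (1.77)"*.  Print-datum
parametrisation of `fun177`; the (b)-instance stays landed (`fun177_toDetBackground`). [cite: Balaban1989LargeFieldI, (1.77) p.194; Balaban1984PropagatorsII, (2.3) p.224] -/
noncomputable def fun177B (𝔅 : BDetSet P) (Qs : GaugeField P k G → GaugeField P 0 G) (Vk : GaugeField P k G) : ℝ :=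
  wilsonAction4 (bgKZB bg 𝔅 Qs Vk)

/-- **PROPOSITION 1's OBJECT OVER `(bg, 𝔅)`**: `VΛ` is *"a minimum of the function"* (1.77) over the variables on the bonds `Λb`, the others frozen at `Vout` — `B15DeterminingSets.IsVLambda`
with `fun177B` for `fun177`.  Existence ∕ uniqueness of the critical orbit = `B15.Prop1Printed` ([Balaban1989LargeFieldII] pp. 358–359), NOT asserted.  The (b)-instance stays landed
(`isVLambda_toDetBackground_iff`). [cite: Balaban1989LargeFieldI, Prop. 1 (1.78) p.194; Balaban1984PropagatorsII, (2.3) p.224] -/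
def IsVLambdaB (𝔅 : BDetSet P) (Qs : GaugeField P k G → GaugeField P 0 G) (Λb : Set (PBond P k)) (Vout VΛ : GaugeField P k G) : Prop :=
  (∀ b, b ∉ Λb → VΛ b = Vout b) ∧
    ∀ W : GaugeField P k G, (∀ b, b ∉ Λb → W b = Vout b) → fun177B bg 𝔅 Qs VΛ ≤ fun177B bg 𝔅 Qs W

/-- **[B15] (1.79) OVER `(bg, 𝔅)`**: `U₀ = U_{k,Z}(V_Λ)` — verbatim p. 195: *"define U₀ = U_{k,Z}(V_Λ). (1.79) This is a fundamental background field for the constructions of this and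
the next sections."*  The (b)-instance `bgU0` stays landed (`bgU0_toDetBackground`). [cite: Balaban1989LargeFieldI, (1.79) p.195; Balaban1984PropagatorsII, (2.3) p.224] -/
def bgU0B (𝔅 : BDetSet P) (Qs : GaugeField P k G → GaugeField P 0 G) (VΛ : GaugeField P k G) : GaugeField P 0 G :=
  bgKZB bg 𝔅 Qs VΛ

variable {bg}

/-- Unfolding of (1.74) over `(bg, 𝔅)`. [cite: Balaban1989LargeFieldI, (1.74) p.192 (bookkeeping)] -/
theorem bgKZB_apply (𝔅 : BDetSet P) (Qs : GaugeField P k G → GaugeField P 0 G) (Vk : GaugeField P k G) :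
    bgKZB bg 𝔅 Qs Vk = bg.U 𝔅 (avgFamily av (Qs Vk)) := rfl

/-- Unfolding of (1.77) over `(bg, 𝔅)`. [cite: Balaban1989LargeFieldI, (1.77) p.194 (bookkeeping)] -/
theorem fun177B_apply (𝔅 : BDetSet P) (Qs : GaugeField P k G → GaugeField P 0 G) (Vk : GaugeField P k G) :
    fun177B bg 𝔅 Qs Vk = wilsonAction4 (bgKZB bg 𝔅 Qs Vk) := rfl

/-- (1.79) is (1.74) at `V_Λ` (definitional). [cite: Balaban1989LargeFieldI, (1.79) p.195 (bookkeeping)] -/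
theorem bgU0B_eq (𝔅 : BDetSet P) (Qs : GaugeField P k G → GaugeField P 0 G) (VΛ : GaugeField P k G) : bgU0B bg 𝔅 Qs VΛ = bgKZB bg 𝔅 Qs VΛ := rfl

end LocalBackgroundsB

/-! ## §2  The site-level (reading-(b)) objects ARE the instance `(bg.toDetBackground, bondsDet 𝔹)` -/

section InstancesB

variable {G : Type*} [GaugeGroup G] {av : ∀ j, Averaging P j G} (bg : DetBackgroundB P G av) {k : ℕ}

/-- **(1.74): `bgKZ` AT THE PULLED-BACK SITE-LEVEL MAP IS `bgKZB` AT THE (b)-DATUM** — `rfl` (F0a `DetBackgroundB.toDetBackground_U`).  With node00-def-R's S2b identity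
`(bgMSCoPOfRecordAtB …).toDetBackground = bgMSCoPOfRecordAt …` this exhibits today's N12 road as the `bondsDet` instance of the road over `DetBackgroundB`.
[cite: Balaban1989LargeFieldI, (1.74) p.192; Balaban1987RG1, (0.1) p.251; Balaban1988Convergent, (2.12)–(2.13) pp.256–257] -/
theorem bgKZ_toDetBackground (BkZ : DetSet P) (Qs : GaugeField P k G → GaugeField P 0 G) : bgKZ bg.toDetBackground BkZ Qs = bgKZB bg (bondsDet BkZ) Qs := rfl

/-- (1.77): `fun177` at the pulled-back map is `fun177B` at the (b)-datum — `rfl`. [cite: Balaban1989LargeFieldI, (1.77) p.194; Balaban1987RG1, (0.1) p.251] -/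
theorem fun177_toDetBackground (BkZ : DetSet P) (Qs : GaugeField P k G → GaugeField P 0 G) : fun177 bg.toDetBackground BkZ Qs = fun177B bg (bondsDet BkZ) Qs := rfl

/-- Prop. 1's minimiser predicate: `IsVLambda` at the pulled-back map is `IsVLambdaB` at the (b)-datum — `Iff.rfl`. [cite: Balaban1989LargeFieldI, Prop. 1 (1.78) p.194; Balaban1987RG1, (0.1) p.251] -/
theorem isVLambda_toDetBackground_iff (BkZ : DetSet P) (Qs : GaugeField P k G → GaugeField P 0 G) (Λb : Set (PBond P k)) (Vout VΛ : GaugeField P k G) :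
    IsVLambda bg.toDetBackground BkZ Qs Λb Vout VΛ ↔ IsVLambdaB bg (bondsDet BkZ) Qs Λb Vout VΛ := Iff.rfl

/-- (1.79): `bgU0` at the pulled-back map is `bgU0B` at the (b)-datum — `rfl`. [cite: Balaban1989LargeFieldI, (1.79) p.195; Balaban1987RG1, (0.1) p.251] -/
theorem bgU0_toDetBackground (BkZ : DetSet P) (Qs : GaugeField P k G → GaugeField P 0 G) : bgU0 bg.toDetBackground BkZ Qs = bgU0B bg (bondsDet BkZ) Qs := rfl

end InstancesB

end Literature.MathematicalPhysics.QuantumFieldTheory.Balaban1983to89.B15DeterminingSetsB
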